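import Summits.Ventures.QEC.Census.BB.A1s_n144_k32_4addf704
import Summits.Ventures.QEC.Census.BB.BBRows
import Summits.Ventures.QEC.Census.BB.Claims
import Literature.InformationTheory.QuantumCodes.TwoBlockConnectedComponents
import HarnessLib
import HarnessLib.Audit.Tags

/-!
# Census row `A1s_n144_k32_4addf704` IS the bivariate-bicycle code `QC(1 + y² + y⁴, y⁶ + x² + x⁴)` on `ℤ₆ × ℤ₁₂`,
# and that TYPED code has parameters `[[144, 32, 4]]` (kernel tier) — PILOT of the census-row ↔ typed-object bridge

The census's KERNEL-std rows (`Census/BB/A1s_*.lean`, qec-search-7's emitter) certify `IsCode n k d` for an EXPLICIT CSS code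
`cert.code _ = CSSCode.ofMatrices (rowMatrix n cert.HX) (rowMatrix n cert.HZ)` given by check-matrix numerals; the CONSTRUCTION
of the row (family BB, `(ℓ, m)`, monomials of `A, B`) appears in the file's docstring and in census/TABLE.tsv, not in the theorem.
With the verified row generator `Census/BB/BBRows.lean` the construction becomes part of the kernel statement at the cost of two
list-equality `decide`s: `cert.HX = BBRows.rowsX la lb`, `cert.HZ = BBRows.rowsZ la lb` (INDEX IDENTITY in the kernel: the
certificate's rows are, row for row, the check rows of `QC(A, B)` in the convention of `BivariateBicycleCodes.lean`), after which
`BBRows.rowMatrix_rowsX/Z` and type-05's `BB.Code.dZ_eq_of_flat / k_eq_of_flat` transport the certified parameters to the typed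
object `qc : BB.Code 6 12 := ⟨polyL la, polyL lb⟩`, i.e. `QC(x⁰y⁰ + y² + y⁴, y⁶ + x² + x⁴)`:

* `qc_hasParams : BB.HasParams qc 144 32 4` — "`QC(1+y²+y⁴, y⁶+x²+x⁴)` on `ℤ₆ × ℤ₁₂` has parameters `[[144,32,4]]`" (the census
  predicate of `Census/BB/Claims.lean`, distance EXACT), hence also `qc.css.IsCode 144 32 4`.

Source row: census/TABLE.tsv `A1s_n144_k32_4addf704` (cell A.1 leader at `(n,k) = (144,32)`), construction from the certificate
`cert/search-3-a1/A1s_n144_k32_4addf704.certA.json` field `code.construction` (`l = 6, m = 12, A_terms = [[0,0],[0,2],[0,4]],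
B_terms = [[0,6],[2,0],[4,0]]`, monomials `xⁱyʲ` as `[i,j]`; same convention string as BCGMRY24 §4). Everything re-checked by the
kernel; tier KERNEL; axioms standard; no `native_decide`. HONEST FRAMING: no new certificate — this file only IDENTIFIES the
already-certified census object with a named algebraic construction; the census comparator columns (printed values, optimality)
are not touched. Pattern for every BB census row (qec-type-05 gen 4; emitter-ready: one file per row, ≈ 60 lines).
-/

namespace Summit.Ventures.QEC.Census.A1s_n144_k32_4addf704

open Matrix Literature.InformationTheory.QuantumCodes BBRows

/-- Equal row lists give equal row matrices, up to the (definitionally trivial) cast of the row-index type. -/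
theorem rowMatrix_cast_of_eq {n : ℕ} {H H' : List ℕ} (h : H = H') :
    rowMatrix n H = (rowMatrix n H').submatrix (Fin.cast (congrArg List.length h)) id := by
  subst h; rfl

/-- Monomials of `A = x⁰y⁰ + x⁰y² + x⁰y⁴` (certificate `A_terms = [[0,0],[0,2],[0,4]]`). DATA. -/
def la : List (BB.Mono 6 12) := [(Fin.ofNat 6 0, Fin.ofNat 12 0), (Fin.ofNat 6 0, Fin.ofNat 12 2), (Fin.ofNat 6 0, Fin.ofNat 12 4)]

/-- Monomials of `B = x⁰y⁶ + x²y⁰ + x⁴y⁰` (certificate `B_terms = [[0,6],[2,0],[4,0]]`). DATA. -/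
def lb : List (BB.Mono 6 12) := [(Fin.ofNat 6 0, Fin.ofNat 12 6), (Fin.ofNat 6 2, Fin.ofNat 12 0), (Fin.ofNat 6 4, Fin.ofNat 12 0)]

/-- The census row's code as a TYPED bivariate-bicycle code: `QC(1 + y² + y⁴, y⁶ + x² + x⁴)` on `ℤ₆ × ℤ₁₂`
(`BB.Code 6 12`, polynomials as the monomial sums `polyL la`, `polyL lb`). (definition) -/
def qc : BB.Code 6 12 := ⟨polyL la, polyL lb⟩

/-- INDEX IDENTITY, `X` side, in the kernel: the certificate's `H^X` rows ARE the `X`-check words of `qc` (`decide +kernel`). -/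
theorem HX_eq_rowsX : A1s_n144_k32_4addf704.cert.HX = rowsX la lb := by
  decide +kernel

/-- INDEX IDENTITY, `Z` side. -/
theorem HZ_eq_rowsZ : A1s_n144_k32_4addf704.cert.HZ = rowsZ la lb := by
  decide +kernel

set_option maxRecDepth 100000 in
/-- The certificate's flat `H^X` is `qc.HXFlat`. -/
theorem rowMatrix_HX_eq : rowMatrix 144 A1s_n144_k32_4addf704.cert.HX = qc.HXFlat :=
  (rowMatrix_cast_of_eq (n := 144) HX_eq_rowsX).trans (rowMatrix_rowsX qc (LA := la) (LB := lb) rfl rfl)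

set_option maxRecDepth 100000 in
/-- The certificate's flat `H^Z` is `qc.HZFlat`. -/
theorem rowMatrix_HZ_eq : rowMatrix 144 A1s_n144_k32_4addf704.cert.HZ = qc.HZFlat :=
  (rowMatrix_cast_of_eq (n := 144) HZ_eq_rowsZ).trans (rowMatrix_rowsZ qc (LA := la) (LB := lb) rfl rfl)

set_option maxRecDepth 100000 in
/-- `d^Z (qc) = 4`, transported from the census certificate (`A1s_n144_k32_4addf704.dZ_eq`) by `BB.Code.dZ_eq_of_flat`. -/
theorem qc_dZ : qc.css.dZ = 4 :=
  (qc.dZ_eq_of_flat (D := A1s_n144_k32_4addf704.cert.code A1s_n144_k32_4addf704.commOK_cert)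
    rowMatrix_HX_eq rowMatrix_HZ_eq).symm.trans A1s_n144_k32_4addf704.dZ_eq

set_option maxRecDepth 100000 in
/-- `k (qc) = 32`, transported from the census certificate (`A1s_n144_k32_4addf704.k_eq`) by `BB.Code.k_eq_of_flat`. -/
theorem qc_k : qc.k = 32 :=
  (qc.k_eq_of_flat (D := A1s_n144_k32_4addf704.cert.code A1s_n144_k32_4addf704.commOK_cert)
    rowMatrix_HX_eq rowMatrix_HZ_eq).symm.trans A1s_n144_k32_4addf704.k_eq

/-- **`QC(1 + y² + y⁴, y⁶ + x² + x⁴)` on `ℤ₆ × ℤ₁₂` has parameters `[[144, 32, 4]]`** (distance exact; `BB.HasParams`, the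
census predicate of family BB) — the census row `A1s_n144_k32_4addf704` read as a statement about the construction. KERNEL. -/
theorem qc_hasParams : Summit.Ventures.QEC.BB.HasParams qc 144 32 4 :=
  BB.hasParams_of_dZ (by simp only [BB.numQubits_eq]) qc_k qc_dZ

/-- The same in the generic census vocabulary: `qc.css.IsCode 144 32 4`. -/
theorem qc_isCode : qc.css.IsCode 144 32 4 :=
  (BB.hasParams_iff_isCode (by decide)).1 qc_hasParams


/-! ## APPEND (qec-type-05 gen 4): the census column «connected» for this row, in the kernel — NOT connected,
`|⟨S⟩| = 18`, 4 components (= 4 × [[36,8,4]] numerically) -/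

/-! ### Connectivity: this row is DISCONNECTED (`|⟨S⟩| = 18` of `ℓm = 72` ⇒ `4` components by Lemma 3 (ii)) -/

/-- The exponent-difference subgroup `⟨S⟩` of `qc` as an explicit finite carrier (18 elements, closed under `0, +, −` —
computed by tools/conn_cert.py, closure re-checked by `decide` below). DATA. -/
def diffList : List (BB.Mono 6 12) := [((0 : Fin 6), (0 : Fin 12)), ((0 : Fin 6), (2 : Fin 12)), ((0 : Fin 6), (4 : Fin 12)), ((0 : Fin 6), (6 : Fin 12)), ((0 : Fin 6), (8 : Fin 12)), ((0 : Fin 6), (10 : Fin 12)), ((2 : Fin 6), (0 : Fin 12)), ((2 : Fin 6), (2 : Fin 12)), ((2 : Fin 6), (4 : Fin 12)), ((2 : Fin 6), (6 : Fin 12)), ((2 : Fin 6), (8 : Fin 12)), ((2 : Fin 6), (10 : Fin 12)), ((4 : Fin 6), (0 : Fin 12)), ((4 : Fin 6), (2 : Fin 12)), ((4 : Fin 6), (4 : Fin 12)), ((4 : Fin 6), (6 : Fin 12)), ((4 : Fin 6), (8 : Fin 12)), ((4 : Fin 6), (10 : Fin 12))]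

set_option maxRecDepth 100000 in
/-- `diffList` contains `0`, is closed under addition and under negation (`decide`). -/
theorem diffList_closed : (((0 : Fin 6), (0 : Fin 12)) : BB.Mono 6 12) ∈ diffList ∧
    (∀ a b : BB.Mono 6 12, a ∈ diffList → b ∈ diffList → a + b ∈ diffList) ∧
    (∀ a : BB.Mono 6 12, a ∈ diffList → -a ∈ diffList) := by
  refine ⟨by decide +kernel, by decide +kernel, by decide +kernel⟩

/-- `⟨S⟩` as an additive subgroup with carrier `diffList`. (definition) -/
def diffSub : AddSubgroup (BB.Mono 6 12) where
  carrier := {x | x ∈ diffList}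
  zero_mem' := diffList_closed.1
  add_mem' := fun {a b} ha hb => diffList_closed.2.1 a b ha hb
  neg_mem' := fun {a} ha => diffList_closed.2.2 a ha

set_option maxRecDepth 100000 in
/-- Every exponent difference inside `A` and inside `B` lies in `diffList` (`decide` over all pairs of `ℤ_6 × ℤ_12`). -/
theorem diffs_mem : (∀ g g' : BB.Mono 6 12, qc.A g ≠ 0 → qc.A g' ≠ 0 → g - g' ∈ diffList) ∧
    (∀ g g' : BB.Mono 6 12, qc.B g ≠ 0 → qc.B g' ≠ 0 → g - g' ∈ diffList) := by
  refine ⟨by decide +kernel, by decide +kernel⟩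

/-- Hence `expDiffSubgroup qc ≤ diffSub`. -/
theorem expDiffSubgroup_le : qc.expDiffSubgroup ≤ diffSub :=
  (AddSubgroup.closure_le diffSub).2 (by
    rintro d (⟨g, g', hg, hg', rfl⟩ | ⟨g, g', hg, hg', rfl⟩)
    · exact diffs_mem.1 g g' hg hg'
    · exact diffs_mem.2 g g' hg hg')

set_option maxRecDepth 100000 in
/-- **The Tanner graph of `qc` is NOT connected** (Bravyi et al. 2024 Lemma 3: `⟨S⟩ ≠ ℤ_6 × ℤ_12` — the element
`(1, 0)` is not an exponent-difference combination). Census column «connected» = false for this row, KERNEL. -/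
theorem qc_tannerGraph_not_connected : ¬ qc.css.tannerGraph.Connected := fun h => by
  have htop := (qc.tannerGraph_connected_iff (fun h => absurd (congrFun h ((0 : Fin 6), (0 : Fin 12))) (by decide))
    (fun h => absurd (congrFun h ((0 : Fin 6), (6 : Fin 12))) (by decide))).1 h
  have hx : (((1 : Fin 6), (0 : Fin 12)) : BB.Mono 6 12) ∈ diffSub := expDiffSubgroup_le (htop ▸ AddSubgroup.mem_top _)
  have hx' : (((1 : Fin 6), (0 : Fin 12)) : BB.Mono 6 12) ∈ diffList := hx
  exact absurd hx' (by decide)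

set_option maxRecDepth 100000 in
/-- Conversely every element of `diffList` IS an exponent-difference combination (BFS certificate from `0`: each element = an
earlier one + one difference inside `A` or `B`; tools/conn_cert.py), so `⟨S⟩ = diffSub` exactly. -/
theorem diffList_le : ∀ x : BB.Mono 6 12, x ∈ diffList → x ∈ qc.expDiffSubgroup := by
  have m0 : (((0 : Fin 6), (0 : Fin 12)) : BB.Mono 6 12) ∈ qc.expDiffSubgroup := qc.expDiffSubgroup.zero_mem
  have m1 : (((0 : Fin 6), (10 : Fin 12)) : BB.Mono 6 12) ∈ qc.expDiffSubgroup := by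
    have e : (((0 : Fin 6), (10 : Fin 12)) : BB.Mono 6 12) =
        ((0 : Fin 6), (0 : Fin 12)) + (((0 : Fin 6), (0 : Fin 12)) - (0, 2)) := by decide
    rw [e]
    exact qc.expDiffSubgroup.add_mem m0 (qc.sub_mem_expDiffSubgroup_A (by decide) (by decide))
  have m2 : (((0 : Fin 6), (8 : Fin 12)) : BB.Mono 6 12) ∈ qc.expDiffSubgroup := by
    have e : (((0 : Fin 6), (8 : Fin 12)) : BB.Mono 6 12) =
        ((0 : Fin 6), (0 : Fin 12)) + (((0 : Fin 6), (0 : Fin 12)) - (0, 4)) := by decide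
    rw [e]
    exact qc.expDiffSubgroup.add_mem m0 (qc.sub_mem_expDiffSubgroup_A (by decide) (by decide))
  have m3 : (((0 : Fin 6), (2 : Fin 12)) : BB.Mono 6 12) ∈ qc.expDiffSubgroup := by
    have e : (((0 : Fin 6), (2 : Fin 12)) : BB.Mono 6 12) =
        ((0 : Fin 6), (0 : Fin 12)) + (((0 : Fin 6), (2 : Fin 12)) - (0, 0)) := by decide
    rw [e]
    exact qc.expDiffSubgroup.add_mem m0 (qc.sub_mem_expDiffSubgroup_A (by decide) (by decide))
  have m4 : (((0 : Fin 6), (4 : Fin 12)) : BB.Mono 6 12) ∈ qc.expDiffSubgroup := by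
    have e : (((0 : Fin 6), (4 : Fin 12)) : BB.Mono 6 12) =
        ((0 : Fin 6), (0 : Fin 12)) + (((0 : Fin 6), (4 : Fin 12)) - (0, 0)) := by decide
    rw [e]
    exact qc.expDiffSubgroup.add_mem m0 (qc.sub_mem_expDiffSubgroup_A (by decide) (by decide))
  have m5 : (((4 : Fin 6), (6 : Fin 12)) : BB.Mono 6 12) ∈ qc.expDiffSubgroup := by
    have e : (((4 : Fin 6), (6 : Fin 12)) : BB.Mono 6 12) =
        ((0 : Fin 6), (0 : Fin 12)) + (((0 : Fin 6), (6 : Fin 12)) - (2, 0)) := by decide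
    rw [e]
    exact qc.expDiffSubgroup.add_mem m0 (qc.sub_mem_expDiffSubgroup_B (by decide) (by decide))
  have m6 : (((2 : Fin 6), (6 : Fin 12)) : BB.Mono 6 12) ∈ qc.expDiffSubgroup := by
    have e : (((2 : Fin 6), (6 : Fin 12)) : BB.Mono 6 12) =
        ((0 : Fin 6), (0 : Fin 12)) + (((0 : Fin 6), (6 : Fin 12)) - (4, 0)) := by decide
    rw [e]
    exact qc.expDiffSubgroup.add_mem m0 (qc.sub_mem_expDiffSubgroup_B (by decide) (by decide))
  have m7 : (((4 : Fin 6), (0 : Fin 12)) : BB.Mono 6 12) ∈ qc.expDiffSubgroup := by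
    have e : (((4 : Fin 6), (0 : Fin 12)) : BB.Mono 6 12) =
        ((0 : Fin 6), (0 : Fin 12)) + (((2 : Fin 6), (0 : Fin 12)) - (4, 0)) := by decide
    rw [e]
    exact qc.expDiffSubgroup.add_mem m0 (qc.sub_mem_expDiffSubgroup_B (by decide) (by decide))
  have m8 : (((2 : Fin 6), (0 : Fin 12)) : BB.Mono 6 12) ∈ qc.expDiffSubgroup := by
    have e : (((2 : Fin 6), (0 : Fin 12)) : BB.Mono 6 12) =
        ((0 : Fin 6), (0 : Fin 12)) + (((4 : Fin 6), (0 : Fin 12)) - (2, 0)) := by decide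
    rw [e]
    exact qc.expDiffSubgroup.add_mem m0 (qc.sub_mem_expDiffSubgroup_B (by decide) (by decide))
  have m9 : (((0 : Fin 6), (6 : Fin 12)) : BB.Mono 6 12) ∈ qc.expDiffSubgroup := by
    have e : (((0 : Fin 6), (6 : Fin 12)) : BB.Mono 6 12) =
        ((0 : Fin 6), (10 : Fin 12)) + (((0 : Fin 6), (0 : Fin 12)) - (0, 4)) := by decide
    rw [e]
    exact qc.expDiffSubgroup.add_mem m1 (qc.sub_mem_expDiffSubgroup_A (by decide) (by decide))
  have m10 : (((4 : Fin 6), (4 : Fin 12)) : BB.Mono 6 12) ∈ qc.expDiffSubgroup := by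
    have e : (((4 : Fin 6), (4 : Fin 12)) : BB.Mono 6 12) =
        ((0 : Fin 6), (10 : Fin 12)) + (((0 : Fin 6), (6 : Fin 12)) - (2, 0)) := by decide
    rw [e]
    exact qc.expDiffSubgroup.add_mem m1 (qc.sub_mem_expDiffSubgroup_B (by decide) (by decide))
  have m11 : (((2 : Fin 6), (4 : Fin 12)) : BB.Mono 6 12) ∈ qc.expDiffSubgroup := by
    have e : (((2 : Fin 6), (4 : Fin 12)) : BB.Mono 6 12) =
        ((0 : Fin 6), (10 : Fin 12)) + (((0 : Fin 6), (6 : Fin 12)) - (4, 0)) := by decide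
    rw [e]
    exact qc.expDiffSubgroup.add_mem m1 (qc.sub_mem_expDiffSubgroup_B (by decide) (by decide))
  have m12 : (((4 : Fin 6), (10 : Fin 12)) : BB.Mono 6 12) ∈ qc.expDiffSubgroup := by
    have e : (((4 : Fin 6), (10 : Fin 12)) : BB.Mono 6 12) =
        ((0 : Fin 6), (10 : Fin 12)) + (((2 : Fin 6), (0 : Fin 12)) - (4, 0)) := by decide
    rw [e]
    exact qc.expDiffSubgroup.add_mem m1 (qc.sub_mem_expDiffSubgroup_B (by decide) (by decide))
  have m13 : (((2 : Fin 6), (10 : Fin 12)) : BB.Mono 6 12) ∈ qc.expDiffSubgroup := by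
    have e : (((2 : Fin 6), (10 : Fin 12)) : BB.Mono 6 12) =
        ((0 : Fin 6), (10 : Fin 12)) + (((4 : Fin 6), (0 : Fin 12)) - (2, 0)) := by decide
    rw [e]
    exact qc.expDiffSubgroup.add_mem m1 (qc.sub_mem_expDiffSubgroup_B (by decide) (by decide))
  have m14 : (((4 : Fin 6), (2 : Fin 12)) : BB.Mono 6 12) ∈ qc.expDiffSubgroup := by
    have e : (((4 : Fin 6), (2 : Fin 12)) : BB.Mono 6 12) =
        ((0 : Fin 6), (8 : Fin 12)) + (((0 : Fin 6), (6 : Fin 12)) - (2, 0)) := by decide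
    rw [e]
    exact qc.expDiffSubgroup.add_mem m2 (qc.sub_mem_expDiffSubgroup_B (by decide) (by decide))
  have m15 : (((2 : Fin 6), (2 : Fin 12)) : BB.Mono 6 12) ∈ qc.expDiffSubgroup := by
    have e : (((2 : Fin 6), (2 : Fin 12)) : BB.Mono 6 12) =
        ((0 : Fin 6), (8 : Fin 12)) + (((0 : Fin 6), (6 : Fin 12)) - (4, 0)) := by decide
    rw [e]
    exact qc.expDiffSubgroup.add_mem m2 (qc.sub_mem_expDiffSubgroup_B (by decide) (by decide))
  have m16 : (((4 : Fin 6), (8 : Fin 12)) : BB.Mono 6 12) ∈ qc.expDiffSubgroup := by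
    have e : (((4 : Fin 6), (8 : Fin 12)) : BB.Mono 6 12) =
        ((0 : Fin 6), (8 : Fin 12)) + (((2 : Fin 6), (0 : Fin 12)) - (4, 0)) := by decide
    rw [e]
    exact qc.expDiffSubgroup.add_mem m2 (qc.sub_mem_expDiffSubgroup_B (by decide) (by decide))
  have m17 : (((2 : Fin 6), (8 : Fin 12)) : BB.Mono 6 12) ∈ qc.expDiffSubgroup := by
    have e : (((2 : Fin 6), (8 : Fin 12)) : BB.Mono 6 12) =
        ((0 : Fin 6), (8 : Fin 12)) + (((4 : Fin 6), (0 : Fin 12)) - (2, 0)) := by decide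
    rw [e]
    exact qc.expDiffSubgroup.add_mem m2 (qc.sub_mem_expDiffSubgroup_B (by decide) (by decide))
  simp only [diffList, List.forall_mem_cons]
  exact ⟨m0, m3, m4, m9, m2, m1, m8, m15, m11, m6, m17, m13, m7, m14, m10, m5, m16, m12, by simp⟩

/-- `⟨S⟩ = diffSub` (`18` elements). -/
theorem expDiffSubgroup_eq : qc.expDiffSubgroup = diffSub :=
  le_antisymm expDiffSubgroup_le (fun x hx => diffList_le x hx)

set_option maxRecDepth 100000 in
/-- `|⟨S⟩| = 18`. -/
theorem card_expDiffSubgroup : Nat.card qc.expDiffSubgroup = 18 := by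
  rw [expDiffSubgroup_eq]
  change Nat.card {x : BB.Mono 6 12 // x ∈ diffList} = 18
  rw [Nat.card_eq_fintype_card]
  decide +kernel

set_option maxRecDepth 100000 in
/-- **The Tanner graph of `qc` has exactly `4` connected components** (BCGMRY24 Lemma 3 (ii): `#components · |⟨S⟩| = ℓm`,
`72 / 18 = 4`); with the tree's connected normal form (`TwoBlockConnectedComponents.lean`) the code is the disjoint union of
`4` copies of the root two-block code over `⟨S⟩` — numerically `4 × [[36, 8, 4]]`. KERNEL. -/
theorem qc_card_connectedComponent : Nat.card qc.css.tannerGraph.ConnectedComponent = 4 := by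
  have h := qc.card_connectedComponent_mul_card
    (fun h => absurd (congrFun h ((0 : Fin 6), (0 : Fin 12))) (by decide))
    (fun h => absurd (congrFun h ((0 : Fin 6), (6 : Fin 12))) (by decide))
  rw [card_expDiffSubgroup] at h
  omega

end Summit.Ventures.QEC.Census.A1s_n144_k32_4addf704
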